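import Mathlib.RingTheory.Localization.AtPrime.Basic
import Mathlib.RingTheory.DiscreteValuationRing.Basic
import Mathlib.RingTheory.AdicCompletion.Basic
import Mathlib.RingTheory.IntegralClosure.IntegrallyClosed
import Mathlib.RingTheory.Polynomial.RationalRoot
import HarnessLib

/-!
# The local ring of a domain at a principal prime `(p)`: `p`-power descent, and a discrete
# valuation ring when `p` has finite multiplicities

Topic `RingTheory/DiscreteValuationRing` (proofs only; no definitions, no named facts). Let `A`
be an integral domain and `p ∈ A` a nonzero element generating a prime ideal, and let
`V = A_(p)` be the localisation at that prime (Mathlib `Localization.AtPrime (Ideal.span {p})`,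
a local ring with residue field `Frac(A/p)` — Mathlib `Ideal.ResidueField`). This file records
the two facts by which `p`-integrality statements DESCEND from `V` to `A`:

* `pow_dvd_of_pow_dvd_algebraMap` — **`pᵏV ∩ A = pᵏA`**: if `pᵏ` divides `a ∈ A` in `V` then it
  divides `a` in `A` (`a·s = pᵏb` with `p ∤ s`, and `p` is prime); with
  `algebraMap_mem_maximalIdeal_iff` (`𝔪_V ∩ A = pA`) and `pow_dvd_of_pow_mul_eq` (`A[1/p] ∩ V = A`
  in the form "`pᵏx = a` with `x ∈ V` forces `pᵏ ∣ a`");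
* `isDiscreteValuationRing_of_forall_exists_not_pow_dvd` — **`V` is a discrete valuation ring
  with uniformizer `p`** as soon as every nonzero `a ∈ A` has finite `p`-multiplicity
  (`∃ n, pⁿ ∤ a`; e.g. `A` noetherian, or `A` `p`-adically separated:
  `exists_not_pow_dvd_of_isHausdorff`): every nonzero element of `V` is `pⁿ·(unit)`; hence `V` is
  integrally closed (`isIntegrallyClosed_localization`), and a root in `Frac A` of a monic
  polynomial over `A` lies in `V` (`exists_algebraMap_eq_of_eval_eq_zero`, Gauss), where it can
  be reduced to the residue field `Frac(A/p)`.

These are the generic form of the descent used for the `p`-adic completion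
`R̂ = ℤ[A₄,A₆][1/H]^∧_p` of Blakestad–Grant 2023 (§2.3: "every elementary symmetric function in
the roots of `φ_ψ(x)` lies in `R̂` …", "Gauss's lemma gives (6)"), whose prime `(p)` is principal
with `R̂/p = 𝔽_p[A₄,A₆][1/H]` a domain, but which is not known to be normal.

## Sources

* N. Bourbaki, *Commutative Algebra*, Ch. VI §3 no. 6, Prop. 9 (a local domain whose maximal
  ideal is principal and `⋂ 𝔪ⁿ = 0` is a discrete valuation ring); Ch. V §1 no. 3
  (integrally closed domains and roots of monic polynomials). [Bourbaki1989CommAlg]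
* H. Matsumura, *Commutative Ring Theory*, Thm. 11.2 (characterisations of DVRs). [Matsumura1986]

Pure proof file about Mathlib's `Localization.AtPrime`, `IsDiscreteValuationRing`.
-/

noncomputable section

namespace Literature.RingTheory.DiscreteValuationRing

variable {A : Type*} [CommRing A] [IsDomain A] (p : A) [hP : (Ideal.span {p}).IsPrime]

omit [IsDomain A] in
/-- Membership in the prime complement of `(p)` is non-divisibility by `p`. [folklore] -/
theorem mem_primeCompl_span_iff {s : A} : s ∈ (Ideal.span {p}).primeCompl ↔ ¬p ∣ s := by
  rw [Ideal.mem_primeCompl_iff, Ideal.mem_span_singleton]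

/-- `A → A_(p)` is injective (`A` a domain). [folklore] -/
theorem algebraMap_localization_injective : Function.Injective (algebraMap A (Localization.AtPrime (Ideal.span {p}))) :=
  IsLocalization.injective (Localization.AtPrime (Ideal.span {p})) (Ideal.span {p}).primeCompl_le_nonZeroDivisors

omit [IsDomain A] in
/-- The maximal ideal of `A_(p)` is generated by `p`. [folklore] -/
theorem maximalIdeal_eq_span :
    IsLocalRing.maximalIdeal (Localization.AtPrime (Ideal.span {p})) =
      Ideal.span {algebraMap A (Localization.AtPrime (Ideal.span {p})) p} := by
  rw [← Localization.AtPrime.map_eq_maximalIdeal, Ideal.map_span, Set.image_singleton]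

omit [IsDomain A] in
/-- `𝔪_V ∩ A = pA`: `a ∈ A` lies in the maximal ideal of `V = A_(p)` iff `p ∣ a`. [folklore] -/
theorem algebraMap_mem_maximalIdeal_iff (a : A) :
    algebraMap A (Localization.AtPrime (Ideal.span {p})) a ∈
      IsLocalRing.maximalIdeal (Localization.AtPrime (Ideal.span {p})) ↔ p ∣ a := by
  rw [IsLocalization.AtPrime.to_map_mem_maximal_iff (Localization.AtPrime (Ideal.span {p})) (Ideal.span {p}) a,
    Ideal.mem_span_singleton]

/-- **`pᵏV ∩ A = pᵏA`** (`p ≠ 0` generating a prime ideal of the domain `A`, `V = A_(p)`): if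
`pᵏ ∣ a` in `V` then `pᵏ ∣ a` in `A`. Proof: `a·s = pᵏ·b` in `A` with `p ∤ s`, and `p` is prime.
[folklore] -/
theorem pow_dvd_of_pow_dvd_algebraMap (hp0 : p ≠ 0) {a : A} {k : ℕ}
    (h : algebraMap A (Localization.AtPrime (Ideal.span {p})) p ^ k ∣
      algebraMap A (Localization.AtPrime (Ideal.span {p})) a) : p ^ k ∣ a := by
  have hp : Prime p := (Ideal.span_singleton_prime hp0).mp hP
  obtain ⟨v, hv⟩ := h
  obtain ⟨⟨b, s⟩, rfl⟩ := IsLocalization.mk'_surjective (Ideal.span {p}).primeCompl v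
  have hs : ¬p ∣ (s : A) := (mem_primeCompl_span_iff p).mp s.2
  -- clear the denominator: `a·s = pᵏ·b` in `A`
  have h1 : algebraMap A (Localization.AtPrime (Ideal.span {p})) (a * s) =
      algebraMap A (Localization.AtPrime (Ideal.span {p})) (p ^ k * b) := by
    rw [map_mul, map_mul, map_pow, hv, mul_assoc, IsLocalization.mk'_spec]
  have h2 : a * s = p ^ k * b := algebraMap_localization_injective p h1
  exact hp.pow_dvd_of_dvd_mul_right k hs ⟨b, h2⟩

/-- **`A[1/p] ∩ V = A`**: if `x ∈ V = A_(p)` and `pᵏ·x = a ∈ A`, then `pᵏ ∣ a` in `A` (so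
`x = a/pᵏ` comes from `A`). [folklore] -/
theorem pow_dvd_of_pow_mul_eq (hp0 : p ≠ 0) {a : A} {k : ℕ} {x : (Localization.AtPrime (Ideal.span {p}))}
    (h : algebraMap A (Localization.AtPrime (Ideal.span {p})) p ^ k * x =
      algebraMap A (Localization.AtPrime (Ideal.span {p})) a) : p ^ k ∣ a :=
  pow_dvd_of_pow_dvd_algebraMap p hp0 ⟨x, h.symm⟩

/-- The uniformizer `p` of `A_(p)` is a prime element. [folklore] -/
theorem prime_algebraMap (hp0 : p ≠ 0) : Prime (algebraMap A (Localization.AtPrime (Ideal.span {p})) p) := by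
  have hne : algebraMap A (Localization.AtPrime (Ideal.span {p})) p ≠ 0 := fun h =>
    hp0 (algebraMap_localization_injective p (h.trans (map_zero _).symm))
  rw [← Ideal.span_singleton_prime hne, ← maximalIdeal_eq_span]
  exact (IsLocalRing.maximalIdeal.isMaximal (Localization.AtPrime (Ideal.span {p}))).isPrime

omit [IsDomain A] hP in
/-- **Extraction of the `p`-part** in `A`: if `a` has finite `p`-multiplicity then
`a = pᵐ·c` with `p ∤ c`. [folklore] -/
theorem exists_eq_pow_mul_not_dvd {a : A} (hfin : ∃ n, ¬p ^ n ∣ a) :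
    ∃ (m : ℕ) (c : A), a = p ^ m * c ∧ ¬p ∣ c := by
  classical
  have hm₀spec : ¬p ^ Nat.find hfin ∣ a := Nat.find_spec hfin
  have hm₀pos : Nat.find hfin ≠ 0 := by
    intro h0
    rw [h0, pow_zero] at hm₀spec
    exact hm₀spec (one_dvd a)
  obtain ⟨m, hm⟩ : ∃ m, Nat.find hfin = m + 1 := ⟨Nat.find hfin - 1, by omega⟩
  have hdvd : p ^ m ∣ a := by
    have := Nat.find_min hfin (m := m) (by omega)
    push Not at this
    exact this
  obtain ⟨c, hc⟩ := hdvd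
  refine ⟨m, c, hc, fun ⟨d, hd⟩ => hm₀spec ⟨d, ?_⟩⟩
  rw [hm, hc, hd]
  ring

/-- **`A_(p)` is a discrete valuation ring with uniformizer `p`** when every nonzero element of
`A` has finite `p`-multiplicity: every nonzero `x = b/s ∈ V` is `pᵐ·(c/s)` with `c/s` a unit.
[Bourbaki AC VI §3 no. 6, Prop. 9; Matsumura Thm. 11.2] [cite: Bourbaki1989CommAlg, VI §3 no. 6 Prop. 9] -/
theorem isDiscreteValuationRing_of_forall_exists_not_pow_dvd (hp0 : p ≠ 0)
    (hfin : ∀ a : A, a ≠ 0 → ∃ n, ¬p ^ n ∣ a) : IsDiscreteValuationRing (Localization.AtPrime (Ideal.span {p})) := by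
  refine IsDiscreteValuationRing.ofHasUnitMulPowIrreducibleFactorization
    ⟨algebraMap A (Localization.AtPrime (Ideal.span {p})) p, (prime_algebraMap p hp0).irreducible, ?_⟩
  intro x hx
  obtain ⟨⟨b, s⟩, rfl⟩ := IsLocalization.mk'_surjective (Ideal.span {p}).primeCompl x
  have hb : b ≠ 0 := by
    rintro rfl
    exact hx (IsLocalization.mk'_zero _)
  obtain ⟨m, c, rfl, hc⟩ := exists_eq_pow_mul_not_dvd p (hfin b hb)
  have hcu : IsUnit (IsLocalization.mk' (Localization.AtPrime (Ideal.span {p})) c s) :=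
    (IsLocalization.AtPrime.isUnit_mk'_iff _ (Ideal.span {p}) c s).mpr ((mem_primeCompl_span_iff p).mpr hc)
  refine ⟨m, hcu.unit, ?_⟩
  rw [IsUnit.unit_spec, ← map_pow, IsLocalization.mul_mk'_eq_mk'_of_mul]

/-- Hence `A_(p)` is integrally closed (under the same hypothesis). [folklore] -/
theorem isIntegrallyClosed_localization (hp0 : p ≠ 0) (hfin : ∀ a : A, a ≠ 0 → ∃ n, ¬p ^ n ∣ a) :
    IsIntegrallyClosed (Localization.AtPrime (Ideal.span {p})) := by
  haveI := isDiscreteValuationRing_of_forall_exists_not_pow_dvd p hp0 hfin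
  infer_instance

omit [IsDomain A] hP in
/-- **Finite `p`-multiplicities in a `p`-adically separated ring**: if `⋂ pⁿA = 0`
(`IsHausdorff (p) A`, e.g. `A` `p`-adically complete) then every `a ≠ 0` has some `pⁿ ∤ a`.
[folklore] -/
theorem exists_not_pow_dvd_of_isHausdorff [IsHausdorff (Ideal.span {p}) A] {a : A} (ha : a ≠ 0) :
    ∃ n, ¬p ^ n ∣ a := by
  by_contra h
  push Not at h
  refine ha (IsHausdorff.haus ‹_› a fun n => ?_)
  rw [SModEq.zero, smul_eq_mul, Ideal.mul_top, Ideal.span_singleton_pow, Ideal.mem_span_singleton]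
  exact h n

/-- **A root in `Frac A` of a monic polynomial over `A` lies in `V = A_(p)`** (Gauss; `V` is
integrally closed with the same fraction field). Stated for any field `K` which is a fraction field
of `V` and an `A`-algebra compatibly. [Bourbaki AC V §1 no. 3] [folklore] -/
theorem exists_algebraMap_eq_of_eval_eq_zero (hp0 : p ≠ 0) (hfin : ∀ a : A, a ≠ 0 → ∃ n, ¬p ^ n ∣ a)
    {K : Type*} [Field K] [Algebra A K] [Algebra (Localization.AtPrime (Ideal.span {p})) K]
    [IsScalarTower A (Localization.AtPrime (Ideal.span {p})) K]
    [IsFractionRing (Localization.AtPrime (Ideal.span {p})) K]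
    {f : Polynomial A} (hf : f.Monic) {θ : K} (hθ : (f.map (algebraMap A K)).eval θ = 0) :
    ∃ x : (Localization.AtPrime (Ideal.span {p})), algebraMap (Localization.AtPrime (Ideal.span {p})) K x = θ := by
  haveI := isIntegrallyClosed_localization p hp0 hfin
  have hint : IsIntegral (Localization.AtPrime (Ideal.span {p})) θ := by
    refine ⟨f.map (algebraMap A (Localization.AtPrime (Ideal.span {p}))), hf.map _, ?_⟩
    rw [Polynomial.eval₂_map, ← IsScalarTower.algebraMap_eq, ← Polynomial.eval_map]
    exact hθ
  exact IsIntegrallyClosed.isIntegral_iff.mp hint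

end Literature.RingTheory.DiscreteValuationRing
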